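import Summits.QuantumFields.YangMills.Theorems.AllWindowsColdBoxBoxHighLinePlaquetteObsL2
import Summits.QuantumFields.YangMills.Theorems.AllWindowsColdBoxBoxHighLinePhiTaylor
import Summits.QuantumFields.YangMills.Theorems.WeakCouplingRatesColdBoxLargeFieldSU2
import Mathlib.Algebra.Order.Chebyshev

/-!
# T-S5.12c `QuarticL2` — the even non-Gaussian parts of the action have `L²(Gaussian)`-size `≲ H⁴/β`
# (task file ✓`…Theorems.AllWindowsColdBoxBoxHighLineStep2Wick`; STUB-PLAN-S5-STEP2 §8; LINE-19 S5 ⟨stmt-QuantumFields-24004⟩/⟨24335⟩)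

Planner ym-idea-2 g18's brick **T-S5.12c** (BOARD 19:54:19Z «UNROUTED: 12c QuarticL2 (after 7a)»; routed to the free-hands seat ym-line-fcl-p3 g26 20:00:40Z):

  `QuarticL2 := ∃ C, ∀ H ≥ 1, ∀ β ≥ H⁴, E₀[quarticWilson²] ≤ C H⁸/β² ∧ E₀[(β(Φ(U(a)) − divLinSq))²] ≤ C H⁸/β²`.

* §1 generic finite-sum inequalities (Mathlib's `sq_sum_le_card_mul_sum_sq`, power mean on `Fin 4 ⊕ Fin 4`), the count `#PT ≤ 9720·H⁴` of plaquettes touching the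
  box (✓`WeakCouplingRates.card_plaquettesTouching_boxEdges_le`), and the EIGHTH MOMENT OF ONE EDGE VARIABLE `E₀‖a_e‖⁸ ≤ 81·C₂²/β⁴` (`C₂ = 60·1036²`), read off
  w5's ✓`PlaqObsL2.gaussAvg_edgeSq_pow_four_le` by viewing `a_e` as the first edge variable of the (degenerate) plaquette `(base e, dir e, dir e)`
  (`norm_apply_eq_norm_plaqVar`, ✓`freeVec_apply_free`) — no new Gaussian computation.
* §2 ★`quarticL2_phi` — the **Φ-half, UNCONDITIONAL**: ✓7b `phiTaylor` clause 2 (`|Φ(U(a)) − divLinSq| ≤ C_Φ·Σ_{x int}(Σ_e|g_xe|‖a_e‖²)²`, no smallness),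
  the eight-edge structure of an interior site (✓`PhiTaylorProof.sum_abs_gradVec_mul`), `(Σ_x A_x²)² ≤ |X|·Σ_x A_x⁴`, `A_x⁴ ≤ 8³·Σ_e|g_xe|‖a_e‖⁸`,
  `|X| ≤ 16H⁴` (✓`PhiTaylorProof.card_interiorSites_le`): `E₀[(β(Φ − divLinSq))²] ≤ C_Φ²·512·8·256·81C₂² · H⁸/β²`.
* §3 ★`quarticL2_wilson_of (h7a)` — the **Wilson half from T-S5.7a** (`WilsonPlaquetteTaylor`, w2's task, hypothesis VERBATIM; only its even first clause is
  used, through w5's ✓`PlaqObsL2.evenRem_sq_le`: `(c_p − ‖ℓ_p‖² − c_p^{odd})² ≤ (C₇² + 144)·S_p⁴` for EVERY field, `S_p = Σ_i‖v_{p,i}‖²`,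
  ✓`PlaqObsL2.linCurvSq_eq_norm_plaqLin_sq`): `quarticWilson² ≤ β²·#PT·(C₇²+144)·Σ_p S_p⁴`, so `E₀[quarticWilson²] ≤ (C₇²+144)·81C₂²·9720² · H⁸/β²`.
* §4 ★`quarticL2_of (h7a : WilsonPlaquetteTaylor) : QuarticL2` — the by-name one-liner `quarticL2 : QuarticL2 := quarticL2_of wilsonPlaquetteTaylor` follows
  the moment w2's `wilsonPlaquetteTaylor` lands.

Tree (✓PlaquetteObsL2 → ✓PlaquetteEdgeMoments/✓QuadFormSplit, ✓PhiTaylor, ✓WeakCouplingRatesColdBoxLargeFieldSU2) + Mathlib; no definitions.  HONEST LABEL: an S brick of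
STEP 2 of the XL stub S5 (`stub_landauSecondOrder`) of a critic-PASSed DRAFT line, its Wilson half CONDITIONAL on T-S5.7a; S5, U5, ⟨24004⟩ ⟨24335⟩ ⟨24336⟩ remain
OPEN; route AllWindowsColdBox is DRAFT; no rung is proved; **the Yang–Mills mass gap is NOT proved by this file; no summit is proved by a line.**
Seat ym-line-fcl-p3 g26 (cell ym-idea-1, free hands on planner ym-idea-2 g18's S5 programme).
-/

set_option autoImplicit false

noncomputable section

open MeasureTheory Matrix Finset Real
open Literature.Probability.LatticeModels (Site)
open Literature.MathematicalPhysics.QuantumLattice (ZdEdge ZdPlaquette plaquettesTouching)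
open Literature.MathematicalPhysics.QuantumFieldTheory.AxialGauge (boxEdges)

namespace Summit.QuantumFields.YangMills.Theorems.AllWindowsColdBoxBoxHighLine

namespace QuarticL2Proof

open PlaqObsL2

/-! ## §1 Generic inequalities, the plaquette count, the eighth moment of one edge variable -/

/-- Power mean on `Fin 4 ⊕ Fin 4`: `(Σ f)⁴ ≤ 512 Σ f⁴` for `f ≥ 0`. -/
theorem pow_four_sum_eight_le (f : Fin 4 ⊕ Fin 4 → ℝ) (hf : ∀ k, 0 ≤ f k) : (∑ k, f k) ^ 4 ≤ 512 * ∑ k, f k ^ 4 := by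
  have h := pow_sum_le_card_mul_sum_pow (s := (Finset.univ : Finset (Fin 4 ⊕ Fin 4))) (f := f) (fun k _ => hf k) 3
  simp only [Finset.card_univ, Fintype.card_sum, Fintype.card_fin] at h
  norm_num at h
  rw [Fintype.sum_sum_type, Fintype.sum_sum_type]
  exact h

/-- `#PT ≤ 9720·H⁴` for the plaquettes touching the box, `H ≥ 1` (✓`card_plaquettesTouching_boxEdges_le`: `≤ 120(2H+1)⁴`). -/
theorem card_touching_le {H : ℕ} (hH : 1 ≤ H) : ((plaquettesTouching (boxEdges 4 (2 * H + 1))).card : ℝ) ≤ 9720 * (H : ℝ) ^ 4 := by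
  have h := Summit.QuantumFields.YangMills.Theorems.WeakCouplingRates.card_plaquettesTouching_boxEdges_le (2 * H + 1)
  have h' : ((plaquettesTouching (boxEdges 4 (2 * H + 1))).card : ℝ) ≤ 120 * (2 * (H : ℝ) + 1) ^ 4 := by exact_mod_cast h
  have hH' : (1 : ℝ) ≤ H := by exact_mod_cast hH
  have h3 : (2 * (H : ℝ) + 1) ^ 4 ≤ (3 * (H : ℝ)) ^ 4 := pow_le_pow_left₀ (by positivity) (by linarith) 4
  nlinarith

variable {H : ℕ}

/-- A free edge variable is the first edge variable of the plaquette `(base e, dir e, dir e)` (✓`freeVec_apply_free`). -/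
theorem norm_apply_eq_norm_plaqVar (a : LandauFree H → E3) (e : LandauFree H) : ‖a e‖ = ‖plaqVar H e.1.1.1 e.1.1.2 e.1.1.2 a 0‖ := by
  simp only [plaqVar, plaqEdge, Matrix.cons_val_zero]
  rw [EdgeChart.freeVec_apply_free]

/-- `‖a_e‖⁸ ≤ S_e⁴` with `S_e` the edge energy of that plaquette. -/
theorem norm_pow_eight_le_edgeSq_pow_four (a : LandauFree H → E3) (e : LandauFree H) :
    ‖a e‖ ^ 8 ≤ (∑ j : Fin 4, ‖plaqVar H e.1.1.1 e.1.1.2 e.1.1.2 a j‖ ^ 2) ^ 4 := by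
  rw [norm_apply_eq_norm_plaqVar, show (8 : ℕ) = 2 * 4 from rfl, pow_mul]
  exact pow_le_pow_left₀ (sq_nonneg _)
    (Finset.single_le_sum (f := fun j => ‖plaqVar H e.1.1.1 e.1.1.2 e.1.1.2 a j‖ ^ 2) (fun j _ => sq_nonneg _) (Finset.mem_univ 0)) 4

/-- The constant `C₈ := 81·(60·1036²)²` of ✓`gaussAvg_edgeSq_pow_four_le`. -/
theorem gaussAvg_edgeSq_pow_four_le' {β : ℝ} (hβ : 0 < β) (e : LandauFree H) :
    gaussAvg β H (fun a => (∑ j : Fin 4, ‖plaqVar H e.1.1.1 e.1.1.2 e.1.1.2 a j‖ ^ 2) ^ 4) ≤ 81 * (60 * 1036 ^ 2) ^ 2 / β ^ 4 :=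
  gaussAvg_edgeSq_pow_four_le H hβ _ _ _

/-! ## §2 The Φ-half (unconditional) -/

/-- At an interior site, `(Σ_e |g_xe| ‖a_e‖²)⁴ ≤ 512 · Σ_e |g_xe| ‖a_e‖⁸` (eight edges meet `x`). -/
theorem site_weight_pow_four_le {x : Site 4} (hx : x ∈ interiorSites H) (a : LandauFree H → E3) :
    (∑ e : LandauFree H, |gradVec H x e| * ‖a e‖ ^ 2) ^ 4 ≤ 512 * ∑ e : LandauFree H, |gradVec H x e| * ‖a e‖ ^ 8 := by
  rw [PhiTaylorProof.sum_abs_gradVec_mul hx (fun e => ‖a e‖ ^ 2), PhiTaylorProof.sum_abs_gradVec_mul hx (fun e => ‖a e‖ ^ 8)]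
  set f : Fin 4 ⊕ Fin 4 → ℝ := Sum.elim (fun μ => ‖a (inEdge hx μ)‖ ^ 2) (fun μ => ‖a (outEdge hx μ)‖ ^ 2) with hf
  have hsum : (∑ μ : Fin 4, ‖a (inEdge hx μ)‖ ^ 2 + ∑ μ : Fin 4, ‖a (outEdge hx μ)‖ ^ 2) = ∑ k, f k := by
    rw [Fintype.sum_sum_type]; rfl
  have hsum8 : (∑ μ : Fin 4, ‖a (inEdge hx μ)‖ ^ 8 + ∑ μ : Fin 4, ‖a (outEdge hx μ)‖ ^ 8) = ∑ k, f k ^ 4 := by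
    rw [Fintype.sum_sum_type]
    simp only [hf, Sum.elim_inl, Sum.elim_inr, ← pow_mul]
  rw [hsum, hsum8]
  exact pow_four_sum_eight_le f fun k => by rcases k with μ | μ <;> simp only [hf, Sum.elim_inl, Sum.elim_inr] <;> positivity

/-- At an interior site, `Σ_e |g_xe| = 8`. -/
theorem sum_abs_gradVec_eq_eight {x : Site 4} (hx : x ∈ interiorSites H) : ∑ e : LandauFree H, |gradVec H x e| = 8 := by
  have h := PhiTaylorProof.sum_abs_gradVec_mul hx (fun _ => (1 : ℝ))
  simp only [mul_one, Finset.sum_const, Finset.card_univ, Fintype.card_fin, nsmul_eq_mul, Nat.cast_ofNat] at h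
  rw [h]; norm_num

/-- **Pointwise majorant for the Φ-half**: `(β(Φ(U(a)) − divLinSq))² ≤ β²C_Φ²·|X|·512·Σ_{x∈X}Σ_e |g_xe|·S_e(a)⁴`. -/
theorem phi_sq_le {CΦ : ℝ} (hCΦ : ∀ a : LandauFree H → E3, |landauPhi H (edgeChart H a) - divLinSq H a| ≤
      CΦ * ∑ x ∈ interiorSites H, (∑ e : LandauFree H, |gradVec H x e| * ‖a e‖ ^ 2) ^ 2) (β : ℝ) (a : LandauFree H → E3) :
    (β * (landauPhi H (edgeChart H a) - divLinSq H a)) ^ 2 ≤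
      (β ^ 2 * CΦ ^ 2 * ((interiorSites H).card * 512)) * ∑ x ∈ interiorSites H, ∑ e : LandauFree H,
        |gradVec H x e| * (∑ j : Fin 4, ‖plaqVar H e.1.1.1 e.1.1.2 e.1.1.2 a j‖ ^ 2) ^ 4 := by
  have h1 := hCΦ a
  -- square the pointwise bound
  have h2 : (landauPhi H (edgeChart H a) - divLinSq H a) ^ 2 ≤ (CΦ * ∑ x ∈ interiorSites H, (∑ e : LandauFree H, |gradVec H x e| * ‖a e‖ ^ 2) ^ 2) ^ 2 := by
    rw [← sq_abs]
    exact pow_le_pow_left₀ (abs_nonneg _) h1 2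
  -- Cauchy–Schwarz over the sites, power mean over the eight edges, one edge ≤ its plaquette energy
  have h3 : (∑ x ∈ interiorSites H, (∑ e : LandauFree H, |gradVec H x e| * ‖a e‖ ^ 2) ^ 2) ^ 2 ≤
      (interiorSites H).card * (512 * ∑ x ∈ interiorSites H, ∑ e : LandauFree H,
        |gradVec H x e| * (∑ j : Fin 4, ‖plaqVar H e.1.1.1 e.1.1.2 e.1.1.2 a j‖ ^ 2) ^ 4) := by
    refine sq_sum_le_card_mul_sum_sq.trans (mul_le_mul_of_nonneg_left ?_ (Nat.cast_nonneg _))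
    rw [Finset.mul_sum]
    refine Finset.sum_le_sum fun x hx => ?_
    rw [← pow_mul]
    refine (site_weight_pow_four_le hx a).trans (mul_le_mul_of_nonneg_left ?_ (by norm_num))
    exact Finset.sum_le_sum fun e _ => mul_le_mul_of_nonneg_left (norm_pow_eight_le_edgeSq_pow_four a e) (abs_nonneg _)
  calc (β * (landauPhi H (edgeChart H a) - divLinSq H a)) ^ 2 = β ^ 2 * (landauPhi H (edgeChart H a) - divLinSq H a) ^ 2 := by ring
    _ ≤ β ^ 2 * (CΦ * ∑ x ∈ interiorSites H, (∑ e : LandauFree H, |gradVec H x e| * ‖a e‖ ^ 2) ^ 2) ^ 2 :=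
        mul_le_mul_of_nonneg_left h2 (sq_nonneg _)
    _ = β ^ 2 * CΦ ^ 2 * (∑ x ∈ interiorSites H, (∑ e : LandauFree H, |gradVec H x e| * ‖a e‖ ^ 2) ^ 2) ^ 2 := by ring
    _ ≤ β ^ 2 * CΦ ^ 2 * ((interiorSites H).card * (512 * ∑ x ∈ interiorSites H, ∑ e : LandauFree H,
          |gradVec H x e| * (∑ j : Fin 4, ‖plaqVar H e.1.1.1 e.1.1.2 e.1.1.2 a j‖ ^ 2) ^ 4)) := mul_le_mul_of_nonneg_left h3 (by positivity)
    _ = _ := by ring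

/-- One term of the Φ-majorant against `gaussWeight` is integrable. -/
theorem integrable_phi_term {β : ℝ} (hβ : 0 < β) (x : Site 4) (e : LandauFree H) (K : ℝ) :
    Integrable (fun a : LandauFree H → E3 =>
      K * (|gradVec H x e| * (∑ j : Fin 4, ‖plaqVar H e.1.1.1 e.1.1.2 e.1.1.2 a j‖ ^ 2) ^ 4) * gaussWeight β H a) := by
  have h := (integrable_edgeSq_pow_mul_gaussWeight H hβ e.1.1.1 e.1.1.2 e.1.1.2 4).const_mul (K * |gradVec H x e|)
  refine h.congr (Filter.Eventually.of_forall fun a => ?_)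
  ring

/-- The Φ-majorant against `gaussWeight` is integrable. -/
theorem integrable_phi_majorant {β : ℝ} (hβ : 0 < β) (K : ℝ) :
    Integrable (fun a : LandauFree H → E3 =>
      (K * ∑ x ∈ interiorSites H, ∑ e : LandauFree H, |gradVec H x e| * (∑ j : Fin 4, ‖plaqVar H e.1.1.1 e.1.1.2 e.1.1.2 a j‖ ^ 2) ^ 4) *
        gaussWeight β H a) := by
  have h := integrable_finsetSum (interiorSites H) fun x _ =>
    integrable_finsetSum (Finset.univ : Finset (LandauFree H)) fun e _ => integrable_phi_term hβ x e K
  refine h.congr (Filter.Eventually.of_forall fun a => ?_)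
  simp only [Finset.mul_sum, Finset.sum_mul]

/-- `gaussAvg` of the Φ-majorant: `≤ K·|X|·8·C₈/β⁴`. -/
theorem gaussAvg_phi_majorant_le {β : ℝ} (hβ : 0 < β) {K : ℝ} (hK : 0 ≤ K) :
    gaussAvg β H (fun a => K * ∑ x ∈ interiorSites H, ∑ e : LandauFree H,
        |gradVec H x e| * (∑ j : Fin 4, ‖plaqVar H e.1.1.1 e.1.1.2 e.1.1.2 a j‖ ^ 2) ^ 4) ≤
      K * ((interiorSites H).card * (8 * (81 * (60 * 1036 ^ 2) ^ 2 / β ^ 4))) := by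
  have hterm : ∀ (x : Site 4) (e : LandauFree H), Integrable (fun a : LandauFree H → E3 =>
      |gradVec H x e| * (∑ j : Fin 4, ‖plaqVar H e.1.1.1 e.1.1.2 e.1.1.2 a j‖ ^ 2) ^ 4 * gaussWeight β H a) := fun x e =>
    (integrable_phi_term hβ x e 1).congr (Filter.Eventually.of_forall fun a => by ring)
  have hsite : ∀ x : Site 4, Integrable (fun a : LandauFree H → E3 =>
      (∑ e : LandauFree H, |gradVec H x e| * (∑ j : Fin 4, ‖plaqVar H e.1.1.1 e.1.1.2 e.1.1.2 a j‖ ^ 2) ^ 4) * gaussWeight β H a) := by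
    intro x
    have h := integrable_finsetSum (Finset.univ : Finset (LandauFree H)) fun e _ => hterm x e
    refine h.congr (Filter.Eventually.of_forall fun a => ?_)
    simp only [Finset.sum_mul]
  rw [gaussAvg_const_mul]
  refine mul_le_mul_of_nonneg_left ?_ hK
  rw [gaussAvg_sum H _ _ fun x _ => hsite x]
  calc ∑ x ∈ interiorSites H, gaussAvg β H (fun a => ∑ e : LandauFree H,
          |gradVec H x e| * (∑ j : Fin 4, ‖plaqVar H e.1.1.1 e.1.1.2 e.1.1.2 a j‖ ^ 2) ^ 4)
      ≤ ∑ x ∈ interiorSites H, 8 * (81 * (60 * 1036 ^ 2) ^ 2 / β ^ 4) := by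
        refine Finset.sum_le_sum fun x hx => ?_
        rw [gaussAvg_sum H _ _ fun e _ => hterm x e]
        calc ∑ e : LandauFree H, gaussAvg β H (fun a => |gradVec H x e| * (∑ j : Fin 4, ‖plaqVar H e.1.1.1 e.1.1.2 e.1.1.2 a j‖ ^ 2) ^ 4)
            = ∑ e : LandauFree H, |gradVec H x e| * gaussAvg β H (fun a => (∑ j : Fin 4, ‖plaqVar H e.1.1.1 e.1.1.2 e.1.1.2 a j‖ ^ 2) ^ 4) :=
              Finset.sum_congr rfl fun e _ => gaussAvg_const_mul H _ _
          _ ≤ ∑ e : LandauFree H, |gradVec H x e| * (81 * (60 * 1036 ^ 2) ^ 2 / β ^ 4) :=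
              Finset.sum_le_sum fun e _ => mul_le_mul_of_nonneg_left (gaussAvg_edgeSq_pow_four_le' hβ e) (abs_nonneg _)
          _ = 8 * (81 * (60 * 1036 ^ 2) ^ 2 / β ^ 4) := by rw [← Finset.sum_mul, sum_abs_gradVec_eq_eight hx]
    _ = (interiorSites H).card * (8 * (81 * (60 * 1036 ^ 2) ^ 2 / β ^ 4)) := by rw [Finset.sum_const, nsmul_eq_mul]

end QuarticL2Proof

open QuarticL2Proof PlaqObsL2 in
/-- ★ **T-S5.12c, Φ-half (unconditional)**: `E₀[(β(Φ(U(a)) − divLinSq))²] ≤ C·H⁸/β²` for `β ≥ H⁴`, `H ≥ 1`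
(`C = C_Φ²·16·512·16·8·81·(60·1036²)²`, `C_Φ` = ✓`phiTaylor`'s constant). -/
theorem quarticL2_phi : ∃ C : ℝ, ∀ H : ℕ, 1 ≤ H → ∀ β : ℝ, (H : ℝ) ^ 4 ≤ β →
    gaussAvg β H (fun a => (β * (landauPhi H (edgeChart H a) - divLinSq H a)) ^ 2) ≤ C * (H : ℝ) ^ 8 / β ^ 2 := by
  obtain ⟨CΦ, hCΦ⟩ := phiTaylor
  set C₈ : ℝ := 81 * (60 * 1036 ^ 2) ^ 2 with hC₈
  refine ⟨CΦ ^ 2 * 16 * 512 * 16 * 8 * C₈, fun H hH β hβ => ?_⟩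
  have hH' : (1 : ℝ) ≤ H := by exact_mod_cast hH
  have hβpos : 0 < β := lt_of_lt_of_le (by positivity) hβ
  have hX := PhiTaylorProof.card_interiorSites_le H
  have hX0 : (0 : ℝ) ≤ (interiorSites H).card := Nat.cast_nonneg _
  have hK : 0 ≤ β ^ 2 * CΦ ^ 2 * ((interiorSites H).card * 512) := by positivity
  calc gaussAvg β H (fun a => (β * (landauPhi H (edgeChart H a) - divLinSq H a)) ^ 2)
      ≤ gaussAvg β H (fun a => (β ^ 2 * CΦ ^ 2 * ((interiorSites H).card * 512)) * ∑ x ∈ interiorSites H, ∑ e : LandauFree H,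
          |gradVec H x e| * (∑ j : Fin 4, ‖plaqVar H e.1.1.1 e.1.1.2 e.1.1.2 a j‖ ^ 2) ^ 4) :=
        gaussAvg_mono H hβpos (fun a => sq_nonneg _) (fun a => phi_sq_le (fun a => (hCΦ H hH a).2.1) β a) (integrable_phi_majorant hβpos _)
    _ ≤ (β ^ 2 * CΦ ^ 2 * ((interiorSites H).card * 512)) * ((interiorSites H).card * (8 * (C₈ / β ^ 4))) :=
        gaussAvg_phi_majorant_le hβpos hK
    _ = CΦ ^ 2 * 512 * 8 * C₈ * ((interiorSites H).card : ℝ) ^ 2 / β ^ 2 := by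
        field_simp
    _ ≤ CΦ ^ 2 * 512 * 8 * C₈ * (16 * (H : ℝ) ^ 4) ^ 2 / β ^ 2 := by
        have h2 : ((interiorSites H).card : ℝ) ^ 2 ≤ (16 * (H : ℝ) ^ 4) ^ 2 := pow_le_pow_left₀ hX0 hX 2
        have hc : 0 ≤ CΦ ^ 2 * 512 * 8 * C₈ := by positivity
        exact div_le_div_of_nonneg_right (mul_le_mul_of_nonneg_left h2 hc) (by positivity)
    _ = CΦ ^ 2 * 16 * 512 * 16 * 8 * C₈ * (H : ℝ) ^ 8 / β ^ 2 := by ring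

namespace QuarticL2Proof

open PlaqObsL2

/-! ## §3 The Wilson half from T-S5.7a -/

/-- **Pointwise majorant for the Wilson half**: if every even remainder satisfies `R_p² ≤ K·S_p⁴` then
`quarticWilson² ≤ β²·#PT·K·Σ_p S_p⁴`. -/
theorem quarticWilson_sq_le {K : ℝ}
    (hK : ∀ (H : ℕ) (x : Site 4) (μ ν : Fin 4), μ ≠ ν → ∀ a : LandauFree H → E3,
      (chartPlaqCost H x μ ν a - linCurvSq H (x, μ, ν) a - chartPlaqCostOdd H x μ ν a) ^ 2 ≤ K * (∑ i : Fin 4, ‖plaqVar H x μ ν a i‖ ^ 2) ^ 4)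
    (β : ℝ) (H : ℕ) (a : LandauFree H → E3) :
    quarticWilson β H a ^ 2 ≤ (β ^ 2 * (plaquettesTouching (boxEdges 4 (2 * H + 1))).card * K) *
      ∑ p ∈ plaquettesTouching (boxEdges 4 (2 * H + 1)), (∑ i : Fin 4, ‖plaqVar H p.1 p.2.1.1 p.2.1.2 a i‖ ^ 2) ^ 4 := by
  unfold quarticWilson
  set PT := plaquettesTouching (boxEdges 4 (2 * H + 1)) with hPT
  have hterm : ∀ p ∈ PT, (chartPlaqCost H p.1 p.2.1.1 p.2.1.2 a - linCurvSq H (p.1, p.2.1.1, p.2.1.2) a -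
      chartPlaqCostOdd H p.1 p.2.1.1 p.2.1.2 a) ^ 2 ≤ K * (∑ i : Fin 4, ‖plaqVar H p.1 p.2.1.1 p.2.1.2 a i‖ ^ 2) ^ 4 :=
    fun p _ => hK H p.1 p.2.1.1 p.2.1.2 (ne_of_lt p.2.2) a
  have hcs := sq_sum_le_card_mul_sum_sq (s := PT) (f := fun p => chartPlaqCost H p.1 p.2.1.1 p.2.1.2 a -
      linCurvSq H (p.1, p.2.1.1, p.2.1.2) a - chartPlaqCostOdd H p.1 p.2.1.1 p.2.1.2 a)
  calc (β * ∑ p ∈ PT, (chartPlaqCost H p.1 p.2.1.1 p.2.1.2 a - linCurvSq H (p.1, p.2.1.1, p.2.1.2) a - chartPlaqCostOdd H p.1 p.2.1.1 p.2.1.2 a)) ^ 2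
      = β ^ 2 * (∑ p ∈ PT, (chartPlaqCost H p.1 p.2.1.1 p.2.1.2 a - linCurvSq H (p.1, p.2.1.1, p.2.1.2) a -
          chartPlaqCostOdd H p.1 p.2.1.1 p.2.1.2 a)) ^ 2 := by ring
    _ ≤ β ^ 2 * ((PT.card : ℝ) * ∑ p ∈ PT, (chartPlaqCost H p.1 p.2.1.1 p.2.1.2 a - linCurvSq H (p.1, p.2.1.1, p.2.1.2) a -
          chartPlaqCostOdd H p.1 p.2.1.1 p.2.1.2 a) ^ 2) := mul_le_mul_of_nonneg_left hcs (sq_nonneg _)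
    _ ≤ β ^ 2 * ((PT.card : ℝ) * ∑ p ∈ PT, K * (∑ i : Fin 4, ‖plaqVar H p.1 p.2.1.1 p.2.1.2 a i‖ ^ 2) ^ 4) :=
        mul_le_mul_of_nonneg_left (mul_le_mul_of_nonneg_left (Finset.sum_le_sum hterm) (Nat.cast_nonneg _)) (sq_nonneg _)
    _ = _ := by rw [← Finset.mul_sum]; ring

/-- The Wilson majorant is integrable against `gaussWeight`. -/
theorem integrable_wilson_majorant (H : ℕ) {β : ℝ} (hβ : 0 < β) (K : ℝ) :
    Integrable (fun a : LandauFree H → E3 =>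
      (K * ∑ p ∈ plaquettesTouching (boxEdges 4 (2 * H + 1)), (∑ i : Fin 4, ‖plaqVar H p.1 p.2.1.1 p.2.1.2 a i‖ ^ 2) ^ 4) * gaussWeight β H a) := by
  have h := integrable_finsetSum (plaquettesTouching (boxEdges 4 (2 * H + 1))) fun p _ =>
    (integrable_edgeSq_pow_mul_gaussWeight H hβ p.1 p.2.1.1 p.2.1.2 4).const_mul K
  refine h.congr (Filter.Eventually.of_forall fun a => ?_)
  simp only [Finset.mul_sum, Finset.sum_mul, mul_assoc]

/-- `gaussAvg` of the Wilson majorant: `≤ K·#PT·C₈/β⁴`. -/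
theorem gaussAvg_wilson_majorant_le (H : ℕ) {β : ℝ} (hβ : 0 < β) {K : ℝ} (hK : 0 ≤ K) :
    gaussAvg β H (fun a => K * ∑ p ∈ plaquettesTouching (boxEdges 4 (2 * H + 1)), (∑ i : Fin 4, ‖plaqVar H p.1 p.2.1.1 p.2.1.2 a i‖ ^ 2) ^ 4) ≤
      K * ((plaquettesTouching (boxEdges 4 (2 * H + 1))).card * (81 * (60 * 1036 ^ 2) ^ 2 / β ^ 4)) := by
  rw [gaussAvg_const_mul]
  refine mul_le_mul_of_nonneg_left ?_ hK
  rw [gaussAvg_sum H _ _ fun p _ => integrable_edgeSq_pow_mul_gaussWeight H hβ p.1 p.2.1.1 p.2.1.2 4]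
  calc ∑ p ∈ plaquettesTouching (boxEdges 4 (2 * H + 1)), gaussAvg β H (fun a => (∑ i : Fin 4, ‖plaqVar H p.1 p.2.1.1 p.2.1.2 a i‖ ^ 2) ^ 4)
      ≤ ∑ p ∈ plaquettesTouching (boxEdges 4 (2 * H + 1)), 81 * (60 * 1036 ^ 2) ^ 2 / β ^ 4 :=
        Finset.sum_le_sum fun p _ => gaussAvg_edgeSq_pow_four_le H hβ p.1 p.2.1.1 p.2.1.2
    _ = (plaquettesTouching (boxEdges 4 (2 * H + 1))).card * (81 * (60 * 1036 ^ 2) ^ 2 / β ^ 4) := by rw [Finset.sum_const, nsmul_eq_mul]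

end QuarticL2Proof

open QuarticL2Proof PlaqObsL2 in
/-- ★ **T-S5.12c, Wilson half, from T-S5.7a**: `WilsonPlaquetteTaylor → ∃ C, ∀ H ≥ 1, ∀ β ≥ H⁴, E₀[quarticWilson²] ≤ C·H⁸/β²`
(`C = (C₇² + 144)·81·(60·1036²)²·9720²`, `C₇` = 7a's constant; only the even first clause of 7a is used, via ✓`PlaqObsL2.evenRem_sq_le`). -/
theorem quarticL2_wilson_of (h7a : WilsonPlaquetteTaylor) : ∃ C : ℝ, ∀ H : ℕ, 1 ≤ H → ∀ β : ℝ, (H : ℝ) ^ 4 ≤ β →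
    gaussAvg β H (fun a => quarticWilson β H a ^ 2) ≤ C * (H : ℝ) ^ 8 / β ^ 2 := by
  obtain ⟨C₇, hC₇⟩ := h7a
  set C₈ : ℝ := 81 * (60 * 1036 ^ 2) ^ 2 with hC₈
  -- the global dominator of every even remainder (w5's `evenRem_sq_le`, after `linCurvSq = ‖plaqLin‖²`)
  have hK : ∀ (H : ℕ) (x : Site 4) (μ ν : Fin 4), μ ≠ ν → ∀ a : LandauFree H → E3,
      (chartPlaqCost H x μ ν a - linCurvSq H (x, μ, ν) a - chartPlaqCostOdd H x μ ν a) ^ 2 ≤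
        (C₇ ^ 2 + 144) * (∑ i : Fin 4, ‖plaqVar H x μ ν a i‖ ^ 2) ^ 4 := by
    intro H x μ ν hμν a
    obtain ⟨T, -, hT⟩ := hC₇ μ ν hμν
    rw [linCurvSq_eq_norm_plaqLin_sq]
    exact evenRem_sq_le H x μ ν (fun t a ht0 ht1 hv => (hT H x t a ht0 ht1 hv).1) a
  refine ⟨(C₇ ^ 2 + 144) * C₈ * 9720 ^ 2, fun H hH β hβ => ?_⟩
  have hH' : (1 : ℝ) ≤ H := by exact_mod_cast hH
  have hβpos : 0 < β := lt_of_lt_of_le (by positivity) hβ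
  set PT := plaquettesTouching (boxEdges 4 (2 * H + 1)) with hPT
  have hPTle : (PT.card : ℝ) ≤ 9720 * (H : ℝ) ^ 4 := card_touching_le hH
  have hPT0 : (0 : ℝ) ≤ PT.card := Nat.cast_nonneg _
  have hc : 0 ≤ β ^ 2 * PT.card * (C₇ ^ 2 + 144) := by positivity
  calc gaussAvg β H (fun a => quarticWilson β H a ^ 2)
      ≤ gaussAvg β H (fun a => (β ^ 2 * PT.card * (C₇ ^ 2 + 144)) * ∑ p ∈ PT, (∑ i : Fin 4, ‖plaqVar H p.1 p.2.1.1 p.2.1.2 a i‖ ^ 2) ^ 4) :=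
        gaussAvg_mono H hβpos (fun a => sq_nonneg _) (fun a => quarticWilson_sq_le hK β H a) (integrable_wilson_majorant H hβpos _)
    _ ≤ (β ^ 2 * PT.card * (C₇ ^ 2 + 144)) * (PT.card * (C₈ / β ^ 4)) := gaussAvg_wilson_majorant_le H hβpos hc
    _ = (C₇ ^ 2 + 144) * C₈ * (PT.card : ℝ) ^ 2 / β ^ 2 := by
        field_simp
    _ ≤ (C₇ ^ 2 + 144) * C₈ * (9720 * (H : ℝ) ^ 4) ^ 2 / β ^ 2 := by
        have h2 : (PT.card : ℝ) ^ 2 ≤ (9720 * (H : ℝ) ^ 4) ^ 2 := pow_le_pow_left₀ hPT0 hPTle 2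
        have hc' : 0 ≤ (C₇ ^ 2 + 144) * C₈ := by positivity
        exact div_le_div_of_nonneg_right (mul_le_mul_of_nonneg_left h2 hc') (by positivity)
    _ = (C₇ ^ 2 + 144) * C₈ * 9720 ^ 2 * (H : ℝ) ^ 8 / β ^ 2 := by ring

/-! ## §4 T-S5.12c by name, modulo T-S5.7a -/

/-- ★★ **T-S5.12c `QuarticL2` from T-S5.7a**: `WilsonPlaquetteTaylor → QuarticL2` (the Φ-half is unconditional, ✓`quarticL2_phi`).
Once w2's `wilsonPlaquetteTaylor : WilsonPlaquetteTaylor` is a tree theorem: `quarticL2 : QuarticL2 := quarticL2_of wilsonPlaquetteTaylor`. -/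
theorem quarticL2_of (h7a : WilsonPlaquetteTaylor) : QuarticL2 := by
  obtain ⟨C₁, hC₁⟩ := quarticL2_wilson_of h7a
  obtain ⟨C₂, hC₂⟩ := quarticL2_phi
  refine ⟨max C₁ C₂, fun H hH β hβ => ?_⟩
  have hH' : (1 : ℝ) ≤ H := by exact_mod_cast hH
  have hβpos : 0 < β := lt_of_lt_of_le (by positivity) hβ
  have h8 : 0 ≤ (H : ℝ) ^ 8 / β ^ 2 := by positivity
  refine ⟨(hC₁ H hH β hβ).trans ?_, (hC₂ H hH β hβ).trans ?_⟩
  · rw [mul_div_assoc, mul_div_assoc]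
    exact mul_le_mul_of_nonneg_right (le_max_left _ _) h8
  · rw [mul_div_assoc, mul_div_assoc]
    exact mul_le_mul_of_nonneg_right (le_max_right _ _) h8

end Summit.QuantumFields.YangMills.Theorems.AllWindowsColdBoxBoxHighLine

end
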